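import Summits.ResolutionOfSingularities.ResolutionOfSingularities.Theorems.HomologicalConductorNoZenoTraceSocleTerminator
import Summits.ResolutionOfSingularities.ResolutionOfSingularities.Theorems.HomologicalConductorNoZenoMaxDominator
import HarnessLib

/-!
# Crux `NoZenoR` / `NoZeno` (stmt-ResolutionOfSingularities-19943 / -16483) — COMPOSITE DOMINATORS («WLOG `O ≤ V`»)

Route `ResolutionOfSingularities/HomologicalConductor`, W4.4 chain, line `thread-composite` r1 (author res-L0-w44-strat-1
g12, `L/res-L0-w44-strat-1/line-thread-composite-r1.lean` 6346627f182982ad, CHAIN v23 (ρ37d)): the TREE HOME of its proved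
§1 / §1c / §1d — «COMPOSITE TRANSPORT» and «COMPOSITE SUPPLY» — over the vocabulary of the line `birth`
(`NoZeno.Birth.tower`, `stub_dominanceInvariance`, `stub_maxDominator`), DEF-FREE: the line's `TowerDominated O A W`
unfolds verbatim to the hypothesis `hdom` below and its `DropsAlong O A W` to the conclusion of `strictDrop_of_dominates`.
OURS (cell res-hironaka): AI-produced and kernel-checked, weaker than expert review; nothing here is a statement of the
manuscript under review (Hironaka 2017); fact-free, counted 0.

THE STATEMENT.  Let `O` be a valuation ring of `K ⊇ k` with `A ⊆ O`, and let `V` be ANY valuation ring of `K`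
containing every stage `T_m = tower O A m` of the canonical `ca`-tower of `A` along `O` (for instance a prime
divisor dominating a thread of germs `(T_(n+1))_(P_(n+1)) ⊆ V`).  Then there is a valuation ring `W ≤ V` — a
COMPOSITE of `V` with a valuation ring of its residue field — which DOMINATES the `O`-tower in the exact
hypothesis form of `NoZeno.Birth.stub_dominanceInvariance`:

  `∀ m, ∀ s ∈ tower O A m, s ∈ W ∧ (s⁻¹ ∈ W → s⁻¹ ∈ O)`,

hence (noetherian stages, `stub_towerNoetherian`) `tower W A m = tower O A m` for all `m`, with `k ⊆ W`, `A ⊆ W`,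
and stage elements have the same units in `W` as in `O`.  Upgrading by `stub_maxDominator`, `W` may be taken
MAXIMAL among the dominators, and then `W < V` as soon as `V` itself does not dominate (some stage element is a
unit of `V` but not of `O` — e.g. the escape element of a thread; so `V` itself is NEVER a dominator along a thread,
the line's «SPEC (A) CORRECTION»).  So every hypothesis of the crux that is universally quantified over valuation
rings (`StrictDrop`, `PersistenceRadical`, the kernel prefix) may be applied to `W < V` with the SAME tower.

THE PROOF (Chevalley in `K`, no residue fields).  For a subring `S ⊆ O ∩ V` whose `O`-units are `V`-units put
`B := S + 𝔪_V = {x | ∃ t ∈ S, v_V (x - t) < 1}` (a subring of `V`) and `J := (𝔪_O ∩ S) + 𝔪_V ⊆ B` (an ideal);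
`J` is proper: `1 = t + a` with `v_O t < 1`, `v_V a < 1` makes `1 - t ∈ S` an `O`-unit (`v_O (1 - t) = 1`) that is
a non-unit of `V`.  Mathlib's `Ideal.image_subset_nonunits_valuationSubring` gives a valuation ring `W ⊇ B` with
`J ⊆ 𝔪_W`; then `𝔪_V ⊆ 𝔪_W` forces `W ≤ V` (`ValuationSubring.nonunits_le_nonunits`), `S ⊆ W`, and an
`s ∈ S` with `s⁻¹ ∉ O` lies in `J ⊆ 𝔪_W`, so `s⁻¹ ∉ W`.  For the tower take `S := ⋃_m T_m`: its `O`-units are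
inverted inside the stages themselves (`TraceSocle.inv_mem_stage`), so they are
`V`-units as soon as `T_m ⊆ V`.  [cite: ZariskiSamuel1960, VI §10 (composite valuations); Bourbaki AC VI §1 no. 2]
-/

noncomputable section

-- single-problem summit: the doubled namespace component `ResolutionOfSingularities` is forced
set_option linter.dupNamespace false

namespace Summit.ResolutionOfSingularities.ResolutionOfSingularities.Theorems.NoZeno.CompositeDominator

open Summit.ResolutionOfSingularities.ResolutionOfSingularities.Theses.HomologicalConductor
open Summit.ResolutionOfSingularities.ResolutionOfSingularities.Theorems.NoZeno.Birth
open Summit.ResolutionOfSingularities.ResolutionOfSingularities.Theorems.NoZeno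

variable {k K : Type} [Field k] [Field K] [Algebra k K]

/-! ## §1 Chevalley in `K`: a valuation ring below `V` dominating a given subring -/

/-- A nonzero element of valuation `< 1` is not inverted in the valuation ring. [folklore] -/
theorem inv_not_mem_of_valuation_lt_one (W : ValuationSubring K) {x : K} (hx : W.valuation x < 1)
    (hx0 : x ≠ 0) : x⁻¹ ∉ W := by
  rcases W.mem_nonunits_iff_or.mp (W.mem_nonunits_iff.mpr hx) with h | h
  · exact absurd h hx0
  · exact h

/-- An element of a valuation ring whose inverse is not in the ring has valuation `< 1`. [folklore] -/
theorem valuation_lt_one_of_inv_not_mem (W : ValuationSubring K) {x : K} (hx : x⁻¹ ∉ W) :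
    W.valuation x < 1 :=
  W.mem_nonunits_iff.mp (W.mem_nonunits_iff_or.mpr (Or.inr hx))

/-- **Chevalley below `V`.**  Let `S ⊆ O ∩ V` be a subring of `K` whose `O`-units are `V`-units
(`s ∈ S`, `s⁻¹ ∈ O ⇒ s⁻¹ ∈ V`, i.e. `𝔪_V ∩ S ⊆ 𝔪_O`).  Then some valuation ring `W ≤ V` contains `S` and
DOMINATES it with respect to `O`: an `s ∈ S` inverted in `W` is inverted in `O`.  (`W` is a composite of `V`
with a valuation ring of `κ(V)` dominating the image of `S_(𝔪_O ∩ S)`; the proof runs in `K`: Chevalley's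
extension theorem `Ideal.image_subset_nonunits_valuationSubring` applied to the ideal `(𝔪_O ∩ S) + 𝔪_V` of the
ring `S + 𝔪_V`.) [cite: ZariskiSamuel1960, VI §10; VI §4 Thm 5] -/
theorem exists_le_dominating (O V : ValuationSubring K) (S : Subring K) (hSO : S ≤ O.toSubring)
    (hSV : S ≤ V.toSubring) (hunit : ∀ s ∈ S, s⁻¹ ∈ O → s⁻¹ ∈ V) :
    ∃ W : ValuationSubring K, W ≤ V ∧ S ≤ W.toSubring ∧ ∀ s ∈ S, s⁻¹ ∈ W → s⁻¹ ∈ O := by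
  classical
  have hvS : ∀ t ∈ S, V.valuation t ≤ 1 := fun t ht => (V.valuation_le_one_iff t).mpr (hSV ht)
  have hvSO : ∀ t ∈ S, O.valuation t ≤ 1 := fun t ht => (O.valuation_le_one_iff t).mpr (hSO ht)
  -- products with a factor of valuation `≤ 1` and a factor of valuation `< 1`
  have hmul : ∀ (U : ValuationSubring K) (a b : K), U.valuation a ≤ 1 → U.valuation b < 1 →
      U.valuation (a * b) < 1 := by
    intro U a b ha hb
    rw [map_mul]
    exact (mul_le_mul_left ha _).trans_lt (by rwa [one_mul])
  -- the ring `B = S + 𝔪_V`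
  let B : Subring K :=
    { carrier := {x | ∃ t ∈ S, V.valuation (x - t) < 1}
      mul_mem' := by
        rintro x y ⟨t, ht, hxt⟩ ⟨t', ht', hyt'⟩
        refine ⟨t * t', S.mul_mem ht ht', ?_⟩
        have hx : V.valuation x ≤ 1 := by
          have : x = t + (x - t) := by ring
          rw [this]
          exact V.valuation.map_add_le (hvS t ht) hxt.le
        have : x * y - t * t' = x * (y - t') + t' * (x - t) := by ring
        rw [this]
        exact V.valuation.map_add_lt (hmul V x _ hx hyt') (hmul V t' _ (hvS t' ht') hxt)
      one_mem' := ⟨1, S.one_mem, by simp⟩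
      add_mem' := by
        rintro x y ⟨t, ht, hxt⟩ ⟨t', ht', hyt'⟩
        refine ⟨t + t', S.add_mem ht ht', ?_⟩
        have : x + y - (t + t') = (x - t) + (y - t') := by ring
        rw [this]
        exact V.valuation.map_add_lt hxt hyt'
      zero_mem' := ⟨0, S.zero_mem, by simp⟩
      neg_mem' := by
        rintro x ⟨t, ht, hxt⟩
        refine ⟨-t, S.neg_mem ht, ?_⟩
        have : -x - -t = -(x - t) := by ring
        rw [this, Valuation.map_neg]
        exact hxt }
  have hmemB : ∀ x : K, x ∈ B ↔ ∃ t ∈ S, V.valuation (x - t) < 1 := fun x => Iff.rfl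
  have hSB : S ≤ B := fun s hs => (hmemB s).mpr ⟨s, hs, by simp⟩
  have hBV : ∀ x ∈ B, V.valuation x ≤ 1 := by
    rintro x ⟨t, ht, hxt⟩
    have : x = t + (x - t) := by ring
    rw [this]
    exact V.valuation.map_add_le (hvS t ht) hxt.le
  -- the ideal `J = (𝔪_O ∩ S) + 𝔪_V` of `B`
  let J : Ideal B :=
    { carrier := {x | ∃ t ∈ S, O.valuation t < 1 ∧ V.valuation ((x : K) - t) < 1}
      add_mem' := by
        rintro x y ⟨t, ht, htO, hxt⟩ ⟨t', ht', ht'O, hyt'⟩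
        refine ⟨t + t', S.add_mem ht ht', O.valuation.map_add_lt htO ht'O, ?_⟩
        have : ((x + y : B) : K) - (t + t') = ((x : K) - t) + ((y : K) - t') := by
          push_cast; ring
        rw [this]
        exact V.valuation.map_add_lt hxt hyt'
      zero_mem' := ⟨0, S.zero_mem, by simp, by simp⟩
      smul_mem' := by
        rintro c x ⟨t, ht, htO, hxt⟩
        obtain ⟨tc, htc, hctc⟩ := (hmemB c).mp c.2
        refine ⟨tc * t, S.mul_mem htc ht, hmul O tc t (hvSO tc htc) htO, ?_⟩
        have : ((c • x : B) : K) - tc * t = (c : K) * ((x : K) - t) + t * ((c : K) - tc) := by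
          rw [smul_eq_mul]; push_cast; ring
        rw [this]
        exact V.valuation.map_add_lt (hmul V _ _ (hBV _ c.2) hxt) (hmul V _ _ (hvS t ht) hctc) }
  have hmemJ : ∀ x : B, x ∈ J ↔ ∃ t ∈ S, O.valuation t < 1 ∧ V.valuation ((x : K) - t) < 1 :=
    fun x => Iff.rfl
  -- `J` is proper
  have hJ : J ≠ ⊤ := by
    intro hJtop
    have h1 : (1 : B) ∈ J := hJtop ▸ Submodule.mem_top
    obtain ⟨t, ht, htO, h1t⟩ := (hmemJ 1).mp h1
    have h1t' : V.valuation (1 - t) < 1 := by simpa using h1t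
    have huO : O.valuation (1 - t) = 1 := O.valuation.map_one_sub_of_lt htO
    have hu0 : (1 - t : K) ≠ 0 := fun h0 => by rw [h0, map_zero] at huO; exact zero_ne_one huO
    have huinvO : (1 - t)⁻¹ ∈ O := by rw [← O.valuation_le_one_iff, map_inv₀, huO, inv_one]
    exact inv_not_mem_of_valuation_lt_one V h1t' hu0 (hunit _ (S.sub_mem S.one_mem ht) huinvO)
  -- Chevalley
  obtain ⟨W, hBW, hJW⟩ := Ideal.image_subset_nonunits_valuationSubring J hJ
  have hJW' : ∀ (x : K) (hxB : x ∈ B), (⟨x, hxB⟩ : B) ∈ J → W.valuation x < 1 := by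
    intro x hxB hxJ
    exact W.mem_nonunits_iff.mp (hJW ⟨⟨x, hxB⟩, hxJ, rfl⟩)
  refine ⟨W, ?_, hSB.trans hBW, ?_⟩
  · -- `𝔪_V ⊆ 𝔪_W`, hence `W ≤ V`
    refine ValuationSubring.nonunits_le_nonunits.mp fun a ha => ?_
    have haV : V.valuation a < 1 := V.mem_nonunits_iff.mp ha
    have haB : a ∈ B := (hmemB a).mpr ⟨0, S.zero_mem, by simpa using haV⟩
    exact W.mem_nonunits_iff.mpr (hJW' a haB ((hmemJ _).mpr ⟨0, S.zero_mem, by simp, by simpa using haV⟩))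
  · -- domination
    intro s hs hsW
    by_contra hsO
    have hs0 : s ≠ 0 := by
      rintro rfl
      exact hsO (by rw [inv_zero]; exact O.zero_mem)
    have hvs : O.valuation s < 1 := valuation_lt_one_of_inv_not_mem O hsO
    have hsJ : (⟨s, hSB hs⟩ : B) ∈ J := (hmemJ _).mpr ⟨s, hs, hvs, by simp⟩
    exact inv_not_mem_of_valuation_lt_one W (hJW' s (hSB hs) hsJ) hs0 hsW

/-! ## §2 The tower: every valuation ring containing the stages has a dominating refinement -/

/-- **COMPOSITE DOMINATOR (piece (A) of line `thread-composite`).**  If a valuation ring `V` of `K` contains every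
stage of the `O`-tower of `A` (`k ⊆ O`, `A ⊆ O`), then some valuation ring `W ≤ V` DOMINATES the `O`-tower in
the sense of `stub_dominanceInvariance`: every stage lies in `W` and its `W`-units are `O`-units.
[cite: ZariskiSamuel1960, VI §10] -/
theorem exists_dominator_le (O : ValuationSubring K) (A : Subalgebra k K) (V : ValuationSubring K)
    (hk : ∀ c : k, algebraMap k K c ∈ O) (hAO : A.toSubring ≤ O.toSubring)
    (hV : ∀ m : ℕ, ∀ s ∈ tower O A m, s ∈ V) :
    ∃ W : ValuationSubring K, W ≤ V ∧
      ∀ m : ℕ, ∀ s ∈ tower O A m, s ∈ W ∧ (s⁻¹ ∈ W → s⁻¹ ∈ O) := by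
  have hmono : Monotone fun m => (tower O A m).toSubring :=
    monotone_nat_of_le_succ fun m x hx => d2rc_mem_tower_of_le O A (Nat.le_succ m) hx
  let S : Subring K := ⨆ m, (tower O A m).toSubring
  have hmem : ∀ x : K, x ∈ S ↔ ∃ m, x ∈ tower O A m := fun x =>
    Subring.mem_iSup_of_directed hmono.directed_le
  have hSO : S ≤ O.toSubring := fun x hx => by
    obtain ⟨m, hm⟩ := (hmem x).mp hx
    exact mem_valuationSubring_of_mem_tower O hk hAO m x hm
  have hSV : S ≤ V.toSubring := fun x hx => by
    obtain ⟨m, hm⟩ := (hmem x).mp hx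
    exact hV m x hm
  have hunit : ∀ s ∈ S, s⁻¹ ∈ O → s⁻¹ ∈ V := fun s hs hsO => by
    obtain ⟨m, hm⟩ := (hmem s).mp hs
    exact hV m _ (TraceSocle.inv_mem_stage O A hk hAO m _ hm hsO)
  obtain ⟨W, hWV, hSW, hdom⟩ := exists_le_dominating O V S hSO hSV hunit
  exact ⟨W, hWV, fun m s hs => ⟨hSW ((hmem s).mpr ⟨m, hs⟩), hdom s ((hmem s).mpr ⟨m, hs⟩)⟩⟩

/-! ## §3 What a dominator inherits: `k`, `A`, the units of the stages, the tower -/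

/-- A dominator of the `O`-tower contains `k`. [folklore] -/
theorem algebraMap_mem_of_dominates (O : ValuationSubring K) (A : Subalgebra k K) (W : ValuationSubring K)
    (hdom : ∀ m : ℕ, ∀ s ∈ tower O A m, s ∈ W ∧ (s⁻¹ ∈ W → s⁻¹ ∈ O)) (c : k) :
    algebraMap k K c ∈ W :=
  (hdom 0 _ ((tower O A 0).algebraMap_mem c)).1

/-- A dominator of the `O`-tower contains `A`. [folklore] -/
theorem le_of_dominates (O : ValuationSubring K) (A : Subalgebra k K) (W : ValuationSubring K)
    (hdom : ∀ m : ℕ, ∀ s ∈ tower O A m, s ∈ W ∧ (s⁻¹ ∈ W → s⁻¹ ∈ O)) :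
    A.toSubring ≤ W.toSubring := fun a ha =>
  (hdom 0 a (by rw [tower_zero]; exact SyzygyFlattening.self_le_locAt O A ha)).1

/-- **Same units.** For a stage element `s ∈ T_m` and a dominator `W`: `s⁻¹ ∈ W ↔ s⁻¹ ∈ O` (the forward
direction is domination, the backward one holds because `T_m` inverts its `O`-units and `T_m ⊆ W`). [folklore] -/
theorem inv_mem_iff_of_dominates (O : ValuationSubring K) (A : Subalgebra k K) (W : ValuationSubring K)
    (hk : ∀ c : k, algebraMap k K c ∈ O) (hAO : A.toSubring ≤ O.toSubring)
    (hdom : ∀ m : ℕ, ∀ s ∈ tower O A m, s ∈ W ∧ (s⁻¹ ∈ W → s⁻¹ ∈ O)) (m : ℕ) {s : K}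
    (hs : s ∈ tower O A m) : s⁻¹ ∈ W ↔ s⁻¹ ∈ O :=
  ⟨(hdom m s hs).2, fun h => (hdom m _ (TraceSocle.inv_mem_stage O A hk hAO m _ hs h)).1⟩

/-- **Same centre.** For a stage element `s ∈ T_m` and a dominator `W`: `W.valuation s < 1 ↔ O.valuation s < 1`.
[folklore] -/
theorem valuation_lt_one_iff_of_dominates (O : ValuationSubring K) (A : Subalgebra k K) (W : ValuationSubring K)
    (hk : ∀ c : k, algebraMap k K c ∈ O) (hAO : A.toSubring ≤ O.toSubring)
    (hdom : ∀ m : ℕ, ∀ s ∈ tower O A m, s ∈ W ∧ (s⁻¹ ∈ W → s⁻¹ ∈ O)) (m : ℕ) {s : K}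
    (hs : s ∈ tower O A m) : W.valuation s < 1 ↔ O.valuation s < 1 := by
  by_cases hs0 : s = 0
  · simp [hs0]
  have hsW : s ∈ W := (hdom m s hs).1
  have hsO : s ∈ O := mem_valuationSubring_of_mem_tower O hk hAO m s hs
  constructor
  · intro h
    exact valuation_lt_one_of_inv_not_mem O fun hinv =>
      inv_not_mem_of_valuation_lt_one W h hs0 ((inv_mem_iff_of_dominates O A W hk hAO hdom m hs).mpr hinv)
  · intro h
    exact valuation_lt_one_of_inv_not_mem W fun hinv =>
      inv_not_mem_of_valuation_lt_one O h hs0 ((inv_mem_iff_of_dominates O A W hk hAO hdom m hs).mp hinv)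

/-- **Same tower** (`stub_dominanceInvariance` + `stub_towerNoetherian`). [folklore] -/
theorem tower_eq_of_dominates (O : ValuationSubring K) (A : Subalgebra k K) (W : ValuationSubring K)
    (hk : ∀ c : k, algebraMap k K c ∈ O) (hA : A.FG) (hfr : IsFractionRing ↥A K)
    (hAO : A.toSubring ≤ O.toSubring)
    (hdom : ∀ m : ℕ, ∀ s ∈ tower O A m, s ∈ W ∧ (s⁻¹ ∈ W → s⁻¹ ∈ O)) (m : ℕ) :
    tower W A m = tower O A m :=
  stub_dominanceInvariance k K O W A hk hAO (stub_towerNoetherian k K O A hk hA hfr hAO) hdom m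

/-- A dominator `W` of the `O`-tower dominates its own tower with respect to its own units, and the
dominators of the `W`-tower (w.r.t. `W`) are exactly the dominators of the `O`-tower (w.r.t. `O`). [folklore] -/
theorem dominates_iff_of_dominates (O : ValuationSubring K) (A : Subalgebra k K) (W : ValuationSubring K)
    (hk : ∀ c : k, algebraMap k K c ∈ O) (hA : A.FG) (hfr : IsFractionRing ↥A K)
    (hAO : A.toSubring ≤ O.toSubring)
    (hdom : ∀ m : ℕ, ∀ s ∈ tower O A m, s ∈ W ∧ (s⁻¹ ∈ W → s⁻¹ ∈ O)) (U : ValuationSubring K) :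
    (∀ m : ℕ, ∀ s ∈ tower W A m, s ∈ U ∧ (s⁻¹ ∈ U → s⁻¹ ∈ W)) ↔
      ∀ m : ℕ, ∀ s ∈ tower O A m, s ∈ U ∧ (s⁻¹ ∈ U → s⁻¹ ∈ O) := by
  have hT : ∀ m, tower W A m = tower O A m := tower_eq_of_dominates O A W hk hA hfr hAO hdom
  constructor
  · intro h m s hs
    have hs' : s ∈ tower W A m := by rw [hT m]; exact hs
    exact ⟨(h m s hs').1, fun hinv => (hdom m s hs).2 ((h m s hs').2 hinv)⟩
  · intro h m s hs
    rw [hT m] at hs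
    exact ⟨(h m s hs).1, fun hinv =>
      (inv_mem_iff_of_dominates O A W hk hAO hdom m hs).mpr ((h m s hs).2 hinv)⟩

/-! ## §4 The maximal dominator below `V` -/

/-- **MAXIMAL COMPOSITE DOMINATOR.**  If `V` contains every stage of the `O`-tower of `A` but is NOT itself a
dominator (some stage element is a unit of `V` and a non-unit of `O` — e.g. the escape element of a thread of
germs inside `V`), then there is a valuation ring `W < V` dominating the `O`-tower which is MAXIMAL among the
dominators: every `U > W` inverts some stage element that `O` does not.  (`exists_dominator_le` gives `W₀ ≤ V`,
`stub_maxDominator` a maximal dominator `W ≥ W₀`; `W` and `V` are overrings of `W₀`, hence comparable, and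
`V ≤ W` would make `V` a dominator.) [cite: ZariskiSamuel1960, VI §10] -/
theorem exists_maxDominator_lt (O : ValuationSubring K) (A : Subalgebra k K) (V : ValuationSubring K)
    (hk : ∀ c : k, algebraMap k K c ∈ O) (hA : A.FG) (hfr : IsFractionRing ↥A K)
    (hAO : A.toSubring ≤ O.toSubring) (hV : ∀ m : ℕ, ∀ s ∈ tower O A m, s ∈ V)
    (hesc : ∃ m : ℕ, ∃ s ∈ tower O A m, s⁻¹ ∈ V ∧ s⁻¹ ∉ O) :
    ∃ W : ValuationSubring K, W < V ∧
      (∀ m : ℕ, ∀ s ∈ tower O A m, s ∈ W ∧ (s⁻¹ ∈ W → s⁻¹ ∈ O)) ∧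
      ∀ U : ValuationSubring K, W < U → ∃ m : ℕ, ∃ s ∈ tower O A m, s⁻¹ ∈ U ∧ s⁻¹ ∉ O := by
  obtain ⟨W₀, hW₀V, hdom₀⟩ := exists_dominator_le O A V hk hAO hV
  have hk₀ : ∀ c : k, algebraMap k K c ∈ W₀ := algebraMap_mem_of_dominates O A W₀ hdom₀
  have hA₀ : A.toSubring ≤ W₀.toSubring := le_of_dominates O A W₀ hdom₀
  have hT₀ : ∀ m, tower W₀ A m = tower O A m := tower_eq_of_dominates O A W₀ hk hA hfr hAO hdom₀
  obtain ⟨W, hW₀W, hdomW, hmaxW⟩ := stub_maxDominator k K W₀ A hk₀ hA₀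
  -- `W` dominates the `O`-tower
  have hdom : ∀ m : ℕ, ∀ s ∈ tower O A m, s ∈ W ∧ (s⁻¹ ∈ W → s⁻¹ ∈ O) :=
    (dominates_iff_of_dominates O A W₀ hk hA hfr hAO hdom₀ W).mp hdomW
  -- maximality, read over the `O`-tower
  have hmax : ∀ U : ValuationSubring K, W < U → ∃ m : ℕ, ∃ s ∈ tower O A m, s⁻¹ ∈ U ∧ s⁻¹ ∉ O := by
    intro U hU
    obtain ⟨m, s, hs, hsU, hsW⟩ := hmaxW U hU
    rw [hT₀ m] at hs
    exact ⟨m, s, hs, hsU, fun hsO => hsW ((inv_mem_iff_of_dominates O A W hk hAO hdom m hs).mpr hsO)⟩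
  obtain ⟨m₁, s₁, hs₁, hs₁V, hs₁O⟩ := hesc
  -- `W` and `V` are overrings of `W₀`, hence comparable; `V ≤ W` would make `V` a dominator
  have hWV : W ≤ V := by
    rcases le_total (⟨W, hW₀W⟩ : {S // W₀ ≤ S}) ⟨V, hW₀V⟩ with h | h
    · exact h
    · exact absurd ((hdom m₁ s₁ hs₁).2 ((show V ≤ W from h) hs₁V)) hs₁O
  refine ⟨W, lt_of_le_of_ne hWV ?_, hdom, hmax⟩
  rintro rfl
  exact hs₁O ((hdom m₁ s₁ hs₁).2 hs₁V)

/-! ## §5 `StrictDrop` along a dominator, and its reading in `V` -/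

/-- **`StrictDrop` ALONG EVERY DOMINATOR.**  `StrictDrop` is universally quantified over valuation rings, so it
applies to a dominator `W` of the `O`-tower (`k ⊆ W`, `A ⊆ W`, same tower): while `T_m` is singular some later
stage carries a nonzero `y ∈ ca (T_(m'))` with `y * x⁻¹ ∉ W` for every nonzero `x ∈ ca (T_m)` — the conductor
value drops strictly in the value group of `W`, not only in that of `O`. [this work; composition only] -/
theorem strictDrop_of_dominates (hD : StrictDrop) (p : ℕ) (hp : p.Prime) (k K : Type) [Field k] [CharP k p]
    [Field K] [Algebra k K] (O : ValuationSubring K) (A : Subalgebra k K) (W : ValuationSubring K)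
    (hk : ∀ c : k, algebraMap k K c ∈ O) (hA : A.FG) (hfr : IsFractionRing ↥A K)
    (hAO : A.toSubring ≤ O.toSubring)
    (hdom : ∀ m : ℕ, ∀ s ∈ tower O A m, s ∈ W ∧ (s⁻¹ ∈ W → s⁻¹ ∈ O)) (m : ℕ)
    (hm : ¬ IsRegularLocalRing ↥(tower O A m)) :
    ∃ m' : ℕ, m < m' ∧ ∃ y ∈ ca (tower O A m'), y ≠ 0 ∧
      ∀ x ∈ ca (tower O A m), x ≠ 0 → y * x⁻¹ ∉ W := by
  have hT : ∀ n, tower W A n = tower O A n := tower_eq_of_dominates O A W hk hA hfr hAO hdom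
  have hkW : ∀ c : k, algebraMap k K c ∈ W := algebraMap_mem_of_dominates O A W hdom
  have hAW : A.toSubring ≤ W.toSubring := le_of_dominates O A W hdom
  have h : ∀ n : ℕ, ¬ IsRegularLocalRing ↥(tower W A n) → ∃ m' : ℕ, n < m' ∧
      ∃ y ∈ ca (tower W A m'), y ≠ 0 ∧ ∀ x ∈ ca (tower W A n), x ≠ 0 → y * x⁻¹ ∉ W :=
    hD p hp k K W A hkW hA hfr hAW
  have hm' : ¬ IsRegularLocalRing ↥(tower W A m) := by rw [hT m]; exact hm
  obtain ⟨m', hmm', y, hy, hy0, hyx⟩ := h m hm'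
  rw [hT m'] at hy
  refine ⟨m', hmm', y, hy, hy0, fun x hx hx0 => hyx x ?_ hx0⟩
  rw [hT m]; exact hx

/-- **Reading a `W`-drop in `V ≥ W`.**  If `y * x⁻¹ ∉ W` and `W ≤ V` then `x * y⁻¹ ∈ V`, i.e.
`V.valuation x ≤ V.valuation y`: a strict drop along the composite `W` is a weak drop along `V` (and, when
`V.valuation x = V.valuation y`, a strict drop of the residue of `y * x⁻¹` with respect to the residue valuation
ring of `W` in `κ(V)`). [folklore] -/
theorem mul_inv_mem_of_mul_inv_not_mem (W V : ValuationSubring K) (hWV : W ≤ V) {x y : K}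
    (h : y * x⁻¹ ∉ W) : x * y⁻¹ ∈ V := by
  have h' : (y * x⁻¹)⁻¹ ∈ W := (W.mem_or_inv_mem _).resolve_left h
  rw [mul_inv_rev, inv_inv] at h'
  exact hWV h'

/-! ## §6 Thread form: a valuation ring containing a thread of germs -/

open Summit.ResolutionOfSingularities.ResolutionOfSingularities.Theorems.NoZeno.SandwichCluster in
/-- **WLOG `O ≤ V` for a thread.**  In the binder shape of the W4.4 thread layer (`Sig.NoDivisorialThread` /
`Sig.NoDivisorialThreadBP`): primes `P m ⊆ T_m` compatible along the tower, an escape element `s ∈ T_(mₑ)` with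
`O.valuation s < 1`, `s ∉ P mₑ`, and a valuation ring `V` containing every thread germ
`D_(n+1) = (T_(n+1))_(P_(n+1))` (`Parasite.locPrime`; e.g. a prime divisor dominating the thread).  Then there
is a MAXIMAL dominator `W` of the `O`-tower with `W < V`: `tower W A m = tower O A m` for all `m`
(`tower_eq_of_dominates`), `k ⊆ W`, `A ⊆ W`, stage elements have the same units in `W` and `O`, every valuation
ring `U > W` inverts a stage element that `O` does not — and `StrictDrop` applies along `W`
(`strictDrop_of_dominates`). [this work] -/
theorem exists_maxDominator_lt_of_thread (O : ValuationSubring K) (A : Subalgebra k K) (V : ValuationSubring K)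
    (hk : ∀ c : k, algebraMap k K c ∈ O) (hA : A.FG) (hfr : IsFractionRing ↥A K)
    (hAO : A.toSubring ≤ O.toSubring)
    (P : ∀ m : ℕ, Ideal ↥(tower O A m)) (hP : ∀ m, (P m).IsPrime)
    (hcompat : ∀ (m : ℕ) (x : K) (hx : x ∈ tower O A m) (hx' : x ∈ tower O A (m + 1)),
      (⟨x, hx'⟩ : ↥(tower O A (m + 1))) ∈ P (m + 1) ↔ (⟨x, hx⟩ : ↥(tower O A m)) ∈ P m)
    (mₑ : ℕ) (s : K) (hsT : s ∈ tower O A mₑ) (hvs : O.valuation s < 1)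
    (hsP : (⟨s, hsT⟩ : ↥(tower O A mₑ)) ∉ P mₑ)
    (hV : ∀ n : ℕ, Parasite.locPrime (tower O A (n + 1)) (P (n + 1)) (hP (n + 1)) ≤ V.toSubring) :
    ∃ W : ValuationSubring K, W < V ∧
      (∀ m : ℕ, ∀ s ∈ tower O A m, s ∈ W ∧ (s⁻¹ ∈ W → s⁻¹ ∈ O)) ∧
      ∀ U : ValuationSubring K, W < U → ∃ m : ℕ, ∃ s ∈ tower O A m, s⁻¹ ∈ U ∧ s⁻¹ ∉ O := by
  -- every stage lies in the next germ, hence in `V`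
  have hV' : ∀ m : ℕ, ∀ t ∈ tower O A m, t ∈ V := fun m t ht =>
    hV m (Parasite.mem_locPrime_of_mem _ _ _ (d2rc_mem_tower_of_le O A (Nat.le_succ m) ht))
  -- the escape element is a unit of the germ `D_(mₑ+1) ⊆ V` and a non-unit of `O`
  have hs0 : s ≠ 0 := Parasite.ne_zero_of_not_mem_ideal (tower O A mₑ) (P mₑ) hsT hsP
  have hsT' : s ∈ tower O A (mₑ + 1) := d2rc_mem_tower_of_le O A (Nat.le_succ mₑ) hsT
  have hsP' : (⟨s, hsT'⟩ : ↥(tower O A (mₑ + 1))) ∉ P (mₑ + 1) :=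
    fun h => hsP ((hcompat mₑ s hsT hsT').mp h)
  have hsV : s⁻¹ ∈ V := hV mₑ (Parasite.inv_mem_locPrime_of_not_mem _ _ _ hsT' hsP')
  have hsO : s⁻¹ ∉ O := inv_not_mem_of_valuation_lt_one O hvs hs0
  exact exists_maxDominator_lt O A V hk hA hfr hAO hV' ⟨mₑ, s, hsT, hsV, hsO⟩

end Summit.ResolutionOfSingularities.ResolutionOfSingularities.Theorems.NoZeno.CompositeDominator

end
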